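import Mathlib
import HarnessLib

/-!
# The model Legendrian stabilisation in `(ℝ³, dz - y dx)`: an explicit arc, its straight-line
# isotopy from the axis, injectivity and immersion of every stage, `C⁰`-smallness

Topic `Literature/Geometry/Symplectic`; infrastructure (brick **M**, "model") for the proof of the
named fact `Literature.Geometry.Symplectic.Gompf1998_addLeftTwists` (`LegendrianRealisation.lean`;
Gompf 1998, §1: *"For any Legendrian knot `K`, we can find a `C⁰`-small isotopy … that adds any
number of left (negative) twists to the canonical framing … (Simply add a spiral to `K`.)"*).
The global proof transports an explicit local model into a Darboux chart along an arc of the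
knot; this file is that local model, for the standard contact form `α₀ = dz - y dx` on `ℝ³`
(whose Legendrian curves are those with `z' = y x'`).  Everything here is elementary real
analysis and is **proved**; no named facts are introduced.

## The construction (namespace `Literature.Geometry.Symplectic.LegendrianModel`)

* `bump t = expNegInvGlue (1 - t²)` — the standard even `C^∞` bump supported in `[-1, 1]`,
  strictly decreasing in `|t|` on its support (`bump_lt_bump`), with derivative `dbump`;
  `Y t = bump (t/4)` (the transverse profile), `comp t = bump (t - 5/2) + bump (t + 5/2)`
  (compensation bumps, supported in `3/2 ≤ |t| ≤ 7/2`).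
* `xd = 1 - A · bump + (A/2) · comp` — the speed of the `x`-coordinate; the amplitude
  `A = (∫ Y) / D`, `D = ∫ Y (bump - comp/2) > 0` (`D_pos`), is fixed by the **closing condition**
  `∫ Y · xd = 0` (`integral_Y_mul_xd`), and `∫ (xd - 1) = 0` (`integral_xd_sub_one`);
  `A · bump 0 > 1` (`one_lt_A_mul_bump_zero`), so `xd < 0` exactly on `(-t₀, t₀)` for a threshold
  `t₀ ∈ (0, 1)` with `bump t₀ = 1/A` (`xd_neg_iff`, `xd_pos_iff`, `xd_eq_zero_iff`).
* `xm t = ∫₀ᵗ xd` — odd, `= t` for `|t| ≥ 7/2` (`xm_eq_self`), `|xm t - t| ≤ 7A`;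
  `zm t = ∫₋₄ᵗ Y · xd` — odd, `= 0` for `|t| ≥ 4`, **negative on `(0, 4)`** (`zm_neg_of_mem`),
  `|zm| ≤ 8 (1 + 2A)`.  The arc `K₁ = (xm, Y, zm)` is Legendrian: `zm' = Y · xm'`.
* `curve τ t = (t + τ (xm t - t), τ Y t, τ zm t) : EuclideanSpace ℝ (Fin 3)` — **the straight-line
  isotopy** from the axis (`curve_zero_left`) to `K₁`, jointly `C^∞` (`contDiff_curve`), equal to
  the axis off `(-4, 4)` (`curve_eq_axisPt`), with velocity `dcurve` (`hasDerivAt_curve`):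
  - `dcurve_ne_zero` — every stage `0 ≤ τ ≤ 1` is an immersion (`x_τ' = 0` forces `|t| ≤ t₀`,
    where `Y' ≠ 0` unless `t = 0`, where `z' ≠ 0`);
  - `curve_injective` — every stage `0 ≤ τ ≤ 1` is injective: `Y` is even and strictly monotone in
    `|t|`, so a double point has parameters `±t`, and `zm` is odd and non-zero on `(-4, 4) ∖ {0}`;
  - `norm_curve_sub_axisPt_le` — `‖curve τ t - (t, 0, 0)‖ ≤ Cmodel`.
* `scurve ε τ t = δ_ε (curve τ (t/ε))` with the contact dilation `dil ε (x, y, z) = (εx, εy, ε²z)`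
  (`δ_ε^* α₀ = ε² α₀`): supported in `|t| < 4ε` (`scurve_eq_axisPt`), injective, immersed
  (`dscurve_ne_zero`), Legendrian at `τ = 1` (`dscurve_one_legendrian`), jointly smooth, and
  **`C⁰`-small**: `‖scurve ε τ t - (t, 0, 0)‖ ≤ ε · Cmodel` for `0 < ε ≤ 1`
  (`norm_scurve_sub_axisPt_le`).

The framing field along the isotopy and the winding computation ("one added twist") are in the
sequel `LegendrianStabilisationFraming.lean`.

## References

* R. E. Gompf, *Handlebody construction of Stein surfaces*, Ann. of Math. 148 (1998), 619–693,
  §1 (p. 4 of arXiv:math/9803019: stabilisation by adding a spiral / zigzag). [Gompf1998]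
* The front `(xm, zm)` of `K₁` is the usual "zigzag" of a Legendrian stabilisation; the
  particular smooth profile, the compensation bumps and all estimates are ad hoc. [folklore]

## Design notes

* All constants are explicit but non-numerical: every inequality used is qualitative
  (monotonicity of the bump, positivity of integrals of non-negative continuous functions with
  non-empty open support), so no decimal estimate of `∫ bump` is ever needed.
* Injectivity of the stages is obtained from the `(y, z)`-projection alone (parity), not from
  the embeddedness of the front.
* `import Mathlib` (calculus, interval integrals, special functions, Euclidean spaces).
* The tree's other `bump`s are different objects (`Literature.Topology.FourManifolds.CollarShrink.bump`
  is the plateau cut-off `smoothTransition (1 - t)`; `…RudnickSarnakN.bump` is a `ContDiffBump`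
  cast to `ℂ`); the present one is needed with *strict* radial monotonicity and an explicit
  derivative (`dbump`), on which the injectivity and framing arguments rest.
-/

noncomputable section

open Real Set Filter MeasureTheory
open scoped Topology ContDiff

namespace Literature.Geometry.Symplectic.LegendrianModel

/-! ### The derivative of Mathlib's `expNegInvGlue` -/

/-- The derivative of `expNegInvGlue` (`x ↦ e^{-1/x}` for `x > 0`, `0` for `x ≤ 0`):
`e^{-1/x} / x²` for `x > 0` and `0` otherwise. [folklore] -/
def dglue (u : ℝ) : ℝ := if 0 < u then exp (-u⁻¹) / u ^ 2 else 0

/-- `expNegInvGlue` is differentiable everywhere with derivative `dglue` (`e^{-1/x}/x²` for `x > 0`, `0` else). [folklore] -/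
theorem hasDerivAt_expNegInvGlue (u : ℝ) : HasDerivAt expNegInvGlue (dglue u) u := by
  rcases lt_trichotomy u 0 with hu | rfl | hu
  · -- locally zero
    have h0 : expNegInvGlue =ᶠ[𝓝 u] fun _ => (0 : ℝ) := by
      filter_upwards [Iio_mem_nhds hu] with v hv
      exact expNegInvGlue.zero_of_nonpos (le_of_lt hv)
    rw [h0.hasDerivAt_iff, dglue, if_neg (not_lt.2 hu.le)]
    exact hasDerivAt_const u 0
  · -- at `0`: differentiable with a local minimum
    have hd : DifferentiableAt ℝ expNegInvGlue 0 :=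
      (expNegInvGlue.contDiff (n := 1)).differentiable (by simp) 0
    have hmin : IsLocalMin expNegInvGlue 0 :=
      Filter.Eventually.of_forall fun v => by
        rw [expNegInvGlue.zero]; exact expNegInvGlue.nonneg v
    have := hd.hasDerivAt
    rw [hmin.deriv_eq_zero] at this
    rwa [dglue, if_neg (lt_irrefl 0)]
  · have h1 : expNegInvGlue =ᶠ[𝓝 u] fun v => exp (-v⁻¹) := by
      filter_upwards [Ioi_mem_nhds hu] with v hv
      simp [expNegInvGlue, not_le.2 (show (0:ℝ) < v from hv)]
    rw [h1.hasDerivAt_iff, dglue, if_pos hu]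
    have h2 : HasDerivAt (fun v : ℝ => -v⁻¹) ((u ^ 2)⁻¹) u :=
      ((hasDerivAt_inv hu.ne').neg).congr_deriv (neg_neg _)
    exact h2.exp.congr_deriv (by rw [div_eq_mul_inv])

/-- `dglue ≥ 0`. [folklore] -/
theorem dglue_nonneg (u : ℝ) : 0 ≤ dglue u := by
  unfold dglue; split_ifs <;> positivity

/-- `dglue x > 0` for `x > 0`. [folklore] -/
theorem dglue_pos {u : ℝ} (hu : 0 < u) : 0 < dglue u := by
  rw [dglue, if_pos hu]; positivity

/-- `dglue x = 0` for `x ≤ 0`. [folklore] -/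
theorem dglue_eq_zero {u : ℝ} (hu : u ≤ 0) : dglue u = 0 := by
  rw [dglue, if_neg (not_lt.2 hu)]

/-- The derivative of `expNegInvGlue` is `dglue`. [folklore] -/
theorem deriv_expNegInvGlue (u : ℝ) : deriv expNegInvGlue u = dglue u :=
  (hasDerivAt_expNegInvGlue u).deriv

/-- `expNegInvGlue` is strictly increasing on `[0, ∞)`. [folklore] -/
theorem strictMonoOn_expNegInvGlue : StrictMonoOn expNegInvGlue (Ici 0) :=
  strictMonoOn_of_deriv_pos (convex_Ici 0) (expNegInvGlue.contDiff (n := 0)).continuous.continuousOn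
    fun x hx => by
      rw [interior_Ici] at hx
      rw [deriv_expNegInvGlue]; exact dglue_pos hx

/-! ### The even bump `φ(t) = e^{-1/(1-t²)}` -/

/-- **The bump** `φ(t) = expNegInvGlue (1 - t²)`: `C^∞`, even, positive exactly on `(-1, 1)`,
strictly decreasing in `|t|` there. [folklore] -/
def bump (t : ℝ) : ℝ := expNegInvGlue (1 - t ^ 2)

/-- The derivative of the bump, `-2t φ(t) / (1 - t²)²` (the formula is `0` for `1 ≤ |t|`). [folklore] -/
def dbump (t : ℝ) : ℝ := dglue (1 - t ^ 2) * (-2 * t)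

/-- The bump is `C^∞`. [folklore] -/
theorem contDiff_bump {n : ℕ∞} : ContDiff ℝ n bump :=
  expNegInvGlue.contDiff.comp (contDiff_const.sub (contDiff_id.pow 2))

/-- The bump is continuous. [folklore] -/
theorem continuous_bump : Continuous bump := (contDiff_bump (n := 0)).continuous

/-- The bump is non-negative. [folklore] -/
theorem bump_nonneg (t : ℝ) : 0 ≤ bump t := expNegInvGlue.nonneg _

/-- The bump is even. [folklore] -/
@[simp] theorem bump_neg (t : ℝ) : bump (-t) = bump t := by simp [bump]

/-- The bump is positive exactly on `(-1, 1)`. [folklore] -/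
theorem bump_pos_iff {t : ℝ} : 0 < bump t ↔ |t| < 1 := by
  rw [bump, ← sq_lt_one_iff_abs_lt_one]
  constructor
  · intro h
    by_contra h'
    exact h.ne' (expNegInvGlue.zero_of_nonpos (by linarith [not_lt.1 h']))
  · intro h; exact expNegInvGlue.pos_of_pos (by linarith)

/-- The bump vanishes exactly off `(-1, 1)`. [folklore] -/
theorem bump_eq_zero_iff {t : ℝ} : bump t = 0 ↔ 1 ≤ |t| := by
  constructor
  · intro h
    by_contra h'
    exact (bump_pos_iff.2 (not_le.1 h')).ne' h
  · intro h
    exact expNegInvGlue.zero_of_nonpos (by nlinarith [abs_nonneg t, sq_abs t])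

/-- The bump vanishes for `1 ≤ |t|`. [folklore] -/
theorem bump_eq_zero {t : ℝ} (ht : 1 ≤ |t|) : bump t = 0 := bump_eq_zero_iff.2 ht

/-- The bump is positive for `|t| < 1`. [folklore] -/
theorem bump_pos {t : ℝ} (ht : |t| < 1) : 0 < bump t := bump_pos_iff.2 ht

/-- `φ(0) > 0`. [folklore] -/
theorem bump_zero_pos : 0 < bump 0 := bump_pos (by simp)

/-- The bump is strictly decreasing in `|t|` on `(-1, 1)`. [folklore] -/
theorem bump_lt_bump {s t : ℝ} (hst : |s| < |t|) (hs : |s| < 1) : bump t < bump s := by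
  rcases le_or_gt 1 |t| with ht | ht
  · rw [bump_eq_zero ht]; exact bump_pos hs
  · have h1 : s ^ 2 < t ^ 2 := by nlinarith [abs_nonneg s, sq_abs s, sq_abs t]
    have ht2 : t ^ 2 < 1 := by nlinarith [abs_nonneg t, sq_abs t]
    exact strictMonoOn_expNegInvGlue (by simp only [mem_Ici]; linarith)
      (by simp only [mem_Ici]; nlinarith) (by linarith)

/-- The bump is non-increasing in `|t|`. [folklore] -/
theorem bump_le_bump {s t : ℝ} (hst : |s| ≤ |t|) : bump t ≤ bump s := by
  rcases hst.lt_or_eq with h | h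
  · rcases lt_or_ge |s| 1 with hs | hs
    · exact (bump_lt_bump h hs).le
    · rw [bump_eq_zero hs, bump_eq_zero (hs.trans hst)]
  · have : s ^ 2 = t ^ 2 := by rw [← sq_abs s, ← sq_abs t, h]
    simp [bump, this]

/-- The bump attains its maximum at `0`. [folklore] -/
theorem bump_le_bump_zero (t : ℝ) : bump t ≤ bump 0 := bump_le_bump (by simp)

/-- Level sets: `φ(s) = φ(t) > 0` forces `|s| = |t|`. [folklore] -/
theorem abs_eq_abs_of_bump_eq {s t : ℝ} (h : bump s = bump t) (ht : 0 < bump t) : |s| = |t| := by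
  rcases lt_trichotomy |s| |t| with hlt | heq | hgt
  · exact absurd h (bump_lt_bump hlt (hlt.trans (bump_pos_iff.1 ht))).ne'
  · exact heq
  · rw [← h] at ht
    exact absurd h (bump_lt_bump hgt (hgt.trans (bump_pos_iff.1 ht))).ne

/-- The derivative of the bump is `dbump`. [folklore] -/
theorem hasDerivAt_bump (t : ℝ) : HasDerivAt bump (dbump t) t := by
  have h1 : HasDerivAt (fun t : ℝ => 1 - t ^ 2) (-2 * t) t := by
    simpa using (hasDerivAt_pow 2 t).const_sub 1
  exact (hasDerivAt_expNegInvGlue _).comp t h1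

/-- `deriv bump = dbump`. [folklore] -/
theorem deriv_bump : deriv bump = dbump := funext fun t => (hasDerivAt_bump t).deriv

/-- `dbump` is continuous. [folklore] -/
theorem continuous_dbump : Continuous dbump := by
  rw [← deriv_bump]; exact (contDiff_bump (n := 1)).continuous_deriv le_rfl

/-- `dbump` vanishes for `1 ≤ |t|`. [folklore] -/
theorem dbump_eq_zero {t : ℝ} (ht : 1 ≤ |t|) : dbump t = 0 := by
  have : 1 - t ^ 2 ≤ 0 := by nlinarith [abs_nonneg t, sq_abs t]
  simp [dbump, dglue_eq_zero this]

/-- `dbump 0 = 0`. [folklore] -/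
@[simp] theorem dbump_zero : dbump 0 = 0 := by simp [dbump]

/-- The bump is strictly decreasing on `(0, 1)`: `dbump < 0` there. [folklore] -/
theorem dbump_neg_of_pos {t : ℝ} (h0 : 0 < t) (h1 : t < 1) : dbump t < 0 := by
  have : 0 < 1 - t ^ 2 := by nlinarith
  have := dglue_pos this
  simp only [dbump]; nlinarith

/-- The bump is strictly increasing on `(-1, 0)`: `dbump > 0` there. [folklore] -/
theorem dbump_pos_of_neg {t : ℝ} (h0 : t < 0) (h1 : -1 < t) : 0 < dbump t := by
  have : 0 < 1 - t ^ 2 := by nlinarith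
  have := dglue_pos this
  simp only [dbump]; nlinarith

/-- `dbump` is odd. [folklore] -/
@[simp] theorem dbump_neg (t : ℝ) : dbump (-t) = -dbump t := by
  simp [dbump]

/-- `dbump t ≠ 0` for `0 < |t| < 1`. [folklore] -/
theorem dbump_ne_zero {t : ℝ} (h0 : t ≠ 0) (h1 : |t| < 1) : dbump t ≠ 0 := by
  rcases lt_or_gt_of_ne h0 with h | h
  · exact (dbump_pos_of_neg h (by linarith [neg_abs_le t, abs_lt.1 h1])).ne'
  · exact (dbump_neg_of_pos h (lt_of_le_of_lt (le_abs_self t) h1)).ne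

/-- The support of the bump lies in `[-1, 1]`. [folklore] -/
theorem bump_eq_zero_of_le {t : ℝ} (ht : 1 ≤ t) : bump t = 0 :=
  bump_eq_zero (ht.trans (le_abs_self t))

/-- The bump vanishes for `t ≤ -1`. [folklore] -/
theorem bump_eq_zero_of_le_neg {t : ℝ} (ht : t ≤ -1) : bump t = 0 :=
  bump_eq_zero (by rw [abs_of_neg (by linarith)]; linarith)

/-- The support of the bump lies in `(-1, 1)`. [folklore] -/
theorem support_bump_subset : Function.support bump ⊆ Ioo (-1) 1 := fun t ht => by
  have h := bump_pos_iff.1 ((bump_nonneg t).lt_of_ne' ht)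
  exact ⟨by linarith [neg_abs_le t, abs_lt.1 h], (le_abs_self t).trans_lt h⟩


/-- The bump has compact support. [folklore] -/
theorem hasCompactSupport_bump : HasCompactSupport bump :=
  HasCompactSupport.intro (isCompact_Icc (a := (-1 : ℝ)) (b := 1)) fun _ ht =>
    Function.notMem_support.1 fun h => ht (Ioo_subset_Icc_self (support_bump_subset h))

/-- The bump is integrable. [folklore] -/
theorem integrable_bump : Integrable bump := continuous_bump.integrable_of_hasCompactSupport hasCompactSupport_bump

/-- `φ(0) = e⁻¹ ≤ 1`. [folklore] -/
theorem bump_zero_le_one : bump 0 ≤ 1 := by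
  simp only [bump]
  rw [show (1 : ℝ) - 0 ^ 2 = 1 by norm_num, expNegInvGlue, if_neg (by norm_num)]
  exact exp_le_one_iff.2 (by norm_num)

/-- The bump is bounded by `1`. [folklore] -/
theorem bump_le_one (t : ℝ) : bump t ≤ 1 := (bump_le_bump_zero t).trans bump_zero_le_one

/-! ### The profile functions: `Y = φ(t/4)`, the compensation bumps, and the constants -/

/-- The transverse profile `Y(t) = φ(t/4)` (the `y`-coordinate of the stabilised arc). [folklore] -/
def Y (t : ℝ) : ℝ := bump (t / 4)

/-- The derivative of `Y`. [folklore] -/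
def dY (t : ℝ) : ℝ := dbump (t / 4) / 4

/-- The compensation profile `φ(t - 5/2) + φ(t + 5/2)`, supported in `3/2 ≤ |t| ≤ 7/2`. [folklore] -/
def comp (t : ℝ) : ℝ := bump (t - 5 / 2) + bump (t + 5 / 2)

/-- `Y` is `C^∞`. [folklore] -/
theorem contDiff_Y {n : ℕ∞} : ContDiff ℝ n Y := contDiff_bump.comp (contDiff_id.div_const 4)

/-- `Y` is continuous. [folklore] -/
theorem continuous_Y : Continuous Y := (contDiff_Y (n := 0)).continuous

/-- `comp` is `C^∞`. [folklore] -/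
theorem contDiff_comp {n : ℕ∞} : ContDiff ℝ n comp :=
  (contDiff_bump.comp (contDiff_id.sub contDiff_const)).add
    (contDiff_bump.comp (contDiff_id.add contDiff_const))

/-- `comp` is continuous. [folklore] -/
theorem continuous_comp : Continuous comp := (contDiff_comp (n := 0)).continuous

/-- `Y ≥ 0`. [folklore] -/
theorem Y_nonneg (t : ℝ) : 0 ≤ Y t := bump_nonneg _

/-- `Y ≤ 1`. [folklore] -/
theorem Y_le_one (t : ℝ) : Y t ≤ 1 := bump_le_one _

/-- `Y` is even. [folklore] -/
@[simp] theorem Y_neg (t : ℝ) : Y (-t) = Y t := by simp [Y, neg_div]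

/-- `Y > 0` exactly on `(-4, 4)`. [folklore] -/
theorem Y_pos_iff {t : ℝ} : 0 < Y t ↔ |t| < 4 := by
  rw [Y, bump_pos_iff, abs_div, abs_of_pos (by norm_num : (0:ℝ) < 4), div_lt_one (by norm_num)]

/-- `Y = 0` exactly off `(-4, 4)`. [folklore] -/
theorem Y_eq_zero_iff {t : ℝ} : Y t = 0 ↔ 4 ≤ |t| := by
  rw [Y, bump_eq_zero_iff, abs_div, abs_of_pos (by norm_num : (0:ℝ) < 4), le_div_iff₀ (by norm_num),
    one_mul]

/-- `Y t > 0` for `|t| < 4`. [folklore] -/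
theorem Y_pos {t : ℝ} (ht : |t| < 4) : 0 < Y t := Y_pos_iff.2 ht

/-- `Y t = 0` for `4 ≤ |t|`. [folklore] -/
theorem Y_eq_zero {t : ℝ} (ht : 4 ≤ |t|) : Y t = 0 := Y_eq_zero_iff.2 ht

/-- Level sets of `Y`: `Y s = Y t > 0` forces `|s| = |t|`. [folklore] -/
theorem abs_eq_abs_of_Y_eq {s t : ℝ} (h : Y s = Y t) (ht : 0 < Y t) : |s| = |t| := by
  have := abs_eq_abs_of_bump_eq h ht
  rw [abs_div, abs_div, abs_of_pos (by norm_num : (0:ℝ) < 4)] at this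
  linarith

/-- The derivative of `Y` is `dY`. [folklore] -/
theorem hasDerivAt_Y (t : ℝ) : HasDerivAt Y (dY t) t := by
  have h : HasDerivAt (fun s : ℝ => s / 4) (1 / 4 : ℝ) t := (hasDerivAt_id t).div_const 4
  have h2 := (hasDerivAt_bump (t / 4)).comp t h
  have h3 : dbump (t / 4) * (1 / 4) = dY t := by rw [dY]; ring
  rw [h3] at h2
  exact h2

/-- `deriv Y = dY`. [folklore] -/
theorem deriv_Y : deriv Y = dY := funext fun t => (hasDerivAt_Y t).deriv

/-- `dY` is continuous. [folklore] -/
theorem continuous_dY : Continuous dY := by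
  rw [← deriv_Y]; exact (contDiff_Y (n := 1)).continuous_deriv le_rfl

/-- `dY 0 = 0`. [folklore] -/
@[simp] theorem dY_zero : dY 0 = 0 := by simp [dY]

/-- `dY` is odd. [folklore] -/
@[simp] theorem dY_neg (t : ℝ) : dY (-t) = -dY t := by simp [dY, neg_div]

/-- `dY < 0` on `(0, 4)`. [folklore] -/
theorem dY_neg_of_pos {t : ℝ} (h0 : 0 < t) (h4 : t < 4) : dY t < 0 := by
  have := dbump_neg_of_pos (t := t / 4) (by positivity) (by linarith)
  simp only [dY]; linarith

/-- `dY > 0` on `(-4, 0)`. [folklore] -/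
theorem dY_pos_of_neg {t : ℝ} (h0 : t < 0) (h4 : -4 < t) : 0 < dY t := by
  have := dbump_pos_of_neg (t := t / 4) (by linarith) (by linarith)
  simp only [dY]; linarith

/-- `dY t ≠ 0` for `0 < |t| < 4`. [folklore] -/
theorem dY_ne_zero {t : ℝ} (h0 : t ≠ 0) (h4 : |t| < 4) : dY t ≠ 0 := by
  rcases lt_or_gt_of_ne h0 with h | h
  · exact (dY_pos_of_neg h (by linarith [neg_abs_le t])).ne'
  · exact (dY_neg_of_pos h (lt_of_le_of_lt (le_abs_self t) h4)).ne

/-- `dY t = 0` for `4 ≤ |t|`. [folklore] -/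
theorem dY_eq_zero {t : ℝ} (ht : 4 ≤ |t|) : dY t = 0 := by
  have : 1 ≤ |t / 4| := by
    rw [abs_div, abs_of_pos (by norm_num : (0:ℝ) < 4), le_div_iff₀ (by norm_num)]; linarith
  simp [dY, dbump_eq_zero this]

/-- `comp ≥ 0`. [folklore] -/
theorem comp_nonneg (t : ℝ) : 0 ≤ comp t := add_nonneg (bump_nonneg _) (bump_nonneg _)

/-- `comp` is even. [folklore] -/
@[simp] theorem comp_neg (t : ℝ) : comp (-t) = comp t := by
  simp only [comp]
  rw [show -t - 5 / 2 = -(t + 5 / 2) by ring, show -t + 5 / 2 = -(t - 5 / 2) by ring, bump_neg,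
    bump_neg, add_comm]

/-- `comp t = 0` for `|t| ≤ 3/2`. [folklore] -/
theorem comp_eq_zero_of_abs_le {t : ℝ} (ht : |t| ≤ 3 / 2) : comp t = 0 := by
  have h1 := abs_le.1 ht
  simp only [comp]
  rw [bump_eq_zero_of_le_neg (by linarith), bump_eq_zero_of_le (by linarith), add_zero]

/-- `comp t = 0` for `7/2 ≤ |t|`. [folklore] -/
theorem comp_eq_zero_of_le_abs {t : ℝ} (ht : 7 / 2 ≤ |t|) : comp t = 0 := by
  simp only [comp]
  rcases le_abs'.1 ht with h | h
  · rw [bump_eq_zero_of_le_neg (by linarith), bump_eq_zero_of_le_neg (by linarith), add_zero]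
  · rw [bump_eq_zero_of_le (by linarith), bump_eq_zero_of_le (by linarith), add_zero]

/-- `comp ≤ 2`. [folklore] -/
theorem comp_le (t : ℝ) : comp t ≤ 2 := by
  have := bump_le_one (t - 5 / 2); have := bump_le_one (t + 5 / 2); simp only [comp]; linarith

/-- `Y` has compact support. [folklore] -/
theorem hasCompactSupport_Y : HasCompactSupport Y :=
  HasCompactSupport.intro (isCompact_Icc (a := (-4 : ℝ)) (b := 4)) fun t ht =>
    Y_eq_zero (by
      by_contra h
      exact ht (mem_Icc.2 ⟨by linarith [neg_abs_le t, not_le.1 h], by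
        linarith [le_abs_self t, not_le.1 h]⟩))

/-- `comp` has compact support. [folklore] -/
theorem hasCompactSupport_comp : HasCompactSupport comp :=
  HasCompactSupport.intro (isCompact_Icc (a := (-4 : ℝ)) (b := 4)) fun t ht =>
    comp_eq_zero_of_le_abs (by
      by_contra h
      exact ht (mem_Icc.2 ⟨by linarith [neg_abs_le t, not_le.1 h], by
        linarith [le_abs_self t, not_le.1 h]⟩))

/-- `Y` is integrable. [folklore] -/
theorem integrable_Y : Integrable Y := continuous_Y.integrable_of_hasCompactSupport hasCompactSupport_Y

/-- `m = ∫ φ`, the mass of the bump. [folklore] -/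
def m : ℝ := ∫ t, bump t

/-- `D = ∫ Y (φ - comp / 2)`, the denominator of the amplitude `A`. [folklore] -/
def D : ℝ := ∫ t, Y t * (bump t - comp t / 2)

/-- The amplitude `A = (∫ Y) / D` of the dip of `x'`, fixed by the closing condition
`∫ Y x' = 0`. [folklore] -/
def A : ℝ := (∫ t, Y t) / D

/-- `m > 0`. [folklore] -/
theorem m_pos : 0 < m := by
  rw [m, integral_pos_iff_support_of_nonneg bump_nonneg integrable_bump]
  have h : Ioo (-1 : ℝ) 1 ⊆ Function.support bump := fun t ht =>
    (bump_pos (abs_lt.2 ⟨ht.1, ht.2⟩)).ne'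
  exact lt_of_lt_of_le (by rw [Real.volume_Ioo, ENNReal.ofReal_pos]; norm_num) (measure_mono h)

/-- `∫ Y > 0`. [folklore] -/
theorem integral_Y_pos : 0 < ∫ t, Y t := by
  rw [integral_pos_iff_support_of_nonneg Y_nonneg integrable_Y]
  have h : Ioo (-4 : ℝ) 4 ⊆ Function.support Y := fun t ht =>
    (Y_pos (abs_lt.2 ⟨ht.1, ht.2⟩)).ne'
  exact lt_of_lt_of_le (by rw [Real.volume_Ioo, ENNReal.ofReal_pos]; norm_num) (measure_mono h)

/-- `∫ comp = 2 m` (translation invariance). [folklore] -/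
theorem integral_comp : ∫ t, comp t = 2 * m := by
  simp only [comp]
  rw [integral_add (integrable_bump.comp_sub_right _) (integrable_bump.comp_add_right _),
    integral_sub_right_eq_self bump, integral_add_right_eq_self bump, m]; ring

/-- `Y · φ` is integrable. [folklore] -/
theorem integrable_Y_mul_bump : Integrable fun t => Y t * bump t :=
  (continuous_Y.mul continuous_bump).integrable_of_hasCompactSupport hasCompactSupport_bump.mul_left

/-- `Y · comp` is integrable. [folklore] -/
theorem integrable_Y_mul_comp : Integrable fun t => Y t * comp t :=
  (continuous_Y.mul continuous_comp).integrable_of_hasCompactSupport hasCompactSupport_comp.mul_left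

/-- Lower bound for the first part of `D`: on the support of `φ`, `Y ≥ φ(1/4)`. [folklore] -/
theorem integral_Y_mul_bump_ge : bump (1 / 4) * m ≤ ∫ t, Y t * bump t := by
  rw [m, ← integral_const_mul]
  refine integral_mono (integrable_bump.const_mul _) integrable_Y_mul_bump fun t => ?_
  show bump (1 / 4) * bump t ≤ Y t * bump t
  rcases eq_or_ne (bump t) 0 with h | h
  · simp [h]
  · have ht : |t| < 1 := bump_pos_iff.1 ((bump_nonneg t).lt_of_ne' h)
    refine mul_le_mul_of_nonneg_right (bump_le_bump ?_) (bump_nonneg t)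
    rw [abs_div, abs_of_pos (by norm_num : (0:ℝ) < 4)]
    rw [abs_of_pos (by norm_num : (0:ℝ) < 1 / 4)]
    linarith

/-- Upper bound for the second part of `D`: on the support of `comp`, `Y ≤ φ(3/8)`. [folklore] -/
theorem integral_Y_mul_comp_le : ∫ t, Y t * comp t ≤ bump (3 / 8) * (2 * m) := by
  rw [← integral_comp, ← integral_const_mul]
  refine integral_mono integrable_Y_mul_comp
    ((continuous_comp.integrable_of_hasCompactSupport hasCompactSupport_comp).const_mul _) fun t => ?_
  show Y t * comp t ≤ bump (3 / 8) * comp t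
  rcases eq_or_ne (comp t) 0 with h | h
  · simp [h]
  · have ht : 3 / 2 < |t| := by
      by_contra h'; exact h (comp_eq_zero_of_abs_le (not_lt.1 h'))
    refine mul_le_mul_of_nonneg_right (bump_le_bump ?_) (comp_nonneg t)
    rw [abs_of_pos (by norm_num : (0:ℝ) < 3 / 8), abs_div, abs_of_pos (by norm_num : (0:ℝ) < 4)]
    linarith

/-- `∫ Y · comp > 0` (both are positive on `(2, 3)`). [folklore] -/
theorem integral_Y_mul_comp_pos : 0 < ∫ t, Y t * comp t := by
  rw [integral_pos_iff_support_of_nonneg (fun t => mul_nonneg (Y_nonneg t) (comp_nonneg t))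
    integrable_Y_mul_comp]
  have h : Ioo (2 : ℝ) 3 ⊆ Function.support fun t => Y t * comp t := fun t ht => by
    have h1 : 0 < Y t := Y_pos (by rw [abs_of_pos (by linarith [ht.1])]; linarith [ht.2])
    have h2 : 0 < comp t := by
      have : 0 < bump (t - 5 / 2) := bump_pos (by rw [abs_lt]; constructor <;> linarith [ht.1, ht.2])
      simp only [comp]; linarith [bump_nonneg (t + 5 / 2)]
    exact (mul_pos h1 h2).ne'
  exact lt_of_lt_of_le (by rw [Real.volume_Ioo, ENNReal.ofReal_pos]; norm_num) (measure_mono h)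

/-- `D = ∫ Y φ - (∫ Y comp) / 2`. [folklore] -/
theorem D_eq : D = (∫ t, Y t * bump t) - (∫ t, Y t * comp t) / 2 := by
  rw [D]
  have : (fun t => Y t * (bump t - comp t / 2)) = fun t => Y t * bump t - (1 / 2) * (Y t * comp t) := by
    funext t; ring
  rw [this, integral_sub integrable_Y_mul_bump (integrable_Y_mul_comp.const_mul _), integral_const_mul]
  ring

/-- **`D > 0`**, since `φ(3/8) < φ(1/4)`. [folklore] -/
theorem D_pos : 0 < D := by
  rw [D_eq]
  have h1 := integral_Y_mul_bump_ge
  have h2 := integral_Y_mul_comp_le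
  have h3 : bump (3 / 8) < bump (1 / 4) :=
    bump_lt_bump (by rw [abs_of_pos (by norm_num : (0:ℝ) < 1 / 4),
      abs_of_pos (by norm_num : (0:ℝ) < 3 / 8)]; norm_num)
      (by rw [abs_of_pos (by norm_num : (0:ℝ) < 1 / 4)]; norm_num)
  nlinarith [m_pos]

/-- `A > 0`. [folklore] -/
theorem A_pos : 0 < A := div_pos integral_Y_pos D_pos

/-- `A D = ∫ Y`. [folklore] -/
theorem A_mul_D : A * D = ∫ t, Y t := div_mul_cancel₀ _ D_pos.ne'

/-- `D < φ(0) ∫ Y`, i.e. **`A φ(0) > 1`**: the dip makes `x'` negative in the middle. [folklore] -/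
theorem one_lt_A_mul_bump_zero : 1 < A * bump 0 := by
  have h1 : ∫ t, Y t * bump t ≤ bump 0 * ∫ t, Y t := by
    rw [← integral_const_mul]
    refine integral_mono integrable_Y_mul_bump (integrable_Y.const_mul _) fun t => ?_
    show Y t * bump t ≤ bump 0 * Y t
    rw [mul_comm (bump 0)]
    exact mul_le_mul_of_nonneg_left (bump_le_bump_zero t) (Y_nonneg t)
  have h2 : D < bump 0 * ∫ t, Y t := by
    rw [D_eq]; linarith [integral_Y_mul_comp_pos]
  have h3 : D < D * (A * bump 0) := by
    calc D < bump 0 * ∫ t, Y t := h2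
      _ = D * (A * bump 0) := by rw [← A_mul_D]; ring
  exact (lt_mul_iff_one_lt_right D_pos).1 h3

/-! ### The longitudinal speed `x'` -/

/-- **The speed `x'(t) = 1 - A φ(t) + (A/2) comp(t)`** of the `x`-coordinate of the stabilised
arc: negative exactly on `(-t₀, t₀)`, equal to `1` for `|t| ≥ 7/2`. [folklore] -/
def xd (t : ℝ) : ℝ := 1 - A * bump t + A / 2 * comp t

/-- `x'` is `C^∞`. [folklore] -/
theorem contDiff_xd {n : ℕ∞} : ContDiff ℝ n xd :=
  (contDiff_const.sub (contDiff_const.mul contDiff_bump)).add (contDiff_const.mul contDiff_comp)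

/-- `x'` is continuous. [folklore] -/
theorem continuous_xd : Continuous xd := (contDiff_xd (n := 0)).continuous

/-- `x'` is even. [folklore] -/
@[simp] theorem xd_neg (t : ℝ) : xd (-t) = xd t := by simp [xd]

/-- For `|t| ≤ 3/2`, `x'(t) = 1 - A φ(t)`. [folklore] -/
theorem xd_eq_of_abs_le {t : ℝ} (ht : |t| ≤ 3 / 2) : xd t = 1 - A * bump t := by
  rw [xd, comp_eq_zero_of_abs_le ht]; ring

/-- For `7/2 ≤ |t|`, `x'(t) = 1`. [folklore] -/
theorem xd_eq_one_of_le_abs {t : ℝ} (ht : 7 / 2 ≤ |t|) : xd t = 1 := by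
  rw [xd, comp_eq_zero_of_le_abs ht, bump_eq_zero (by linarith)]; ring

/-- `x'(0) < 0`: the arc backtracks in the middle. [folklore] -/
theorem xd_zero_neg : xd 0 < 0 := by
  rw [xd_eq_of_abs_le (by norm_num)]; linarith [one_lt_A_mul_bump_zero]

/-- `|x' - 1| ≤ 2A`. [folklore] -/
theorem abs_xd_sub_one_le (t : ℝ) : |xd t - 1| ≤ 2 * A := by
  have hA := A_pos
  have h1 : |xd t - 1| ≤ A * bump t + A / 2 * comp t := by
    rw [xd, show 1 - A * bump t + A / 2 * comp t - 1 = A / 2 * comp t - A * bump t by ring]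
    refine (abs_sub _ _).trans ?_
    rw [abs_of_nonneg (mul_nonneg (by linarith) (comp_nonneg t)),
      abs_of_nonneg (mul_nonneg hA.le (bump_nonneg t))]
    linarith
  have := bump_le_one t; have := comp_le t
  nlinarith

/-! ### The sign structure of `x'`: the threshold `t₀` -/

/-- There is `t₀ ∈ (0, 1)` with `φ(t₀) = 1/A` (intermediate value theorem). [folklore] -/
theorem exists_t0 : ∃ t0 ∈ Ioo (0 : ℝ) 1, bump t0 = 1 / A := by
  have hA := A_pos
  have h1 : 1 / A ∈ Icc (bump 1) (bump 0) := by
    rw [bump_eq_zero_of_le le_rfl]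
    refine ⟨(div_pos one_pos hA).le, ?_⟩
    rw [div_le_iff₀ hA, mul_comm]; exact one_lt_A_mul_bump_zero.le
  obtain ⟨t0, ht0, h⟩ := intermediate_value_Icc' zero_le_one continuous_bump.continuousOn h1
  refine ⟨t0, ⟨ht0.1.lt_of_ne ?_, ht0.2.lt_of_ne ?_⟩, h⟩
  · rintro rfl
    have : A * bump 0 = 1 := by rw [h]; field_simp
    linarith [one_lt_A_mul_bump_zero]
  · rintro rfl
    rw [bump_eq_zero_of_le le_rfl] at h
    exact absurd h.symm (div_pos one_pos hA).ne'

/-- **The threshold** `t₀ ∈ (0, 1)` with `φ(t₀) = 1/A`: `x' < 0` exactly on `(-t₀, t₀)`. [folklore] -/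
def t0 : ℝ := Classical.choose exists_t0

/-- `t₀ ∈ (0, 1)`. [folklore] -/
theorem t0_mem : t0 ∈ Ioo (0 : ℝ) 1 := (Classical.choose_spec exists_t0).1

/-- `φ(t₀) = 1/A`. [folklore] -/
theorem bump_t0 : bump t0 = 1 / A := (Classical.choose_spec exists_t0).2

/-- `0 < t₀`. [folklore] -/
theorem t0_pos : 0 < t0 := t0_mem.1

/-- `t₀ < 1`. [folklore] -/
theorem t0_lt_one : t0 < 1 := t0_mem.2

/-- `|t₀| = t₀`. [folklore] -/
theorem abs_t0 : |t0| = t0 := abs_of_pos t0_pos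

/-- `x'(t) > 0` for `t₀ < |t|`. [folklore] -/
theorem xd_pos_of_lt_abs {t : ℝ} (ht : t0 < |t|) : 0 < xd t := by
  have hA := A_pos
  rcases le_or_gt |t| (3 / 2) with h | h
  · rw [xd_eq_of_abs_le h]
    have h1 : bump t < bump t0 := bump_lt_bump (by rwa [abs_t0]) (by rw [abs_t0]; exact t0_lt_one)
    rw [bump_t0] at h1
    have : A * bump t < 1 := by rwa [lt_div_iff₀ hA, mul_comm] at h1
    linarith
  · rw [xd, bump_eq_zero (by linarith)]
    have := comp_nonneg t
    nlinarith

/-- `x'(t) < 0` for `|t| < t₀`. [folklore] -/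
theorem xd_neg_of_abs_lt {t : ℝ} (ht : |t| < t0) : xd t < 0 := by
  have hA := A_pos
  rw [xd_eq_of_abs_le (by linarith [t0_lt_one])]
  have h1 : bump t0 < bump t := bump_lt_bump (by rwa [abs_t0]) (ht.trans t0_lt_one)
  rw [bump_t0] at h1
  have : 1 < A * bump t := by rwa [div_lt_iff₀ hA, mul_comm] at h1
  linarith

/-- `x'(t) = 0` for `|t| = t₀`. [folklore] -/
theorem xd_eq_zero_of_abs_eq {t : ℝ} (ht : |t| = t0) : xd t = 0 := by
  have hA := A_pos
  rw [xd_eq_of_abs_le (by linarith [t0_lt_one])]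
  have : bump t = bump t0 := by
    have h1 : t ^ 2 = t0 ^ 2 := by rw [← sq_abs t, ht]
    simp [bump, h1]
  rw [this, bump_t0]; field_simp; ring

/-- `x'(t) > 0 ↔ t₀ < |t|`. [folklore] -/
theorem xd_pos_iff {t : ℝ} : 0 < xd t ↔ t0 < |t| := by
  refine ⟨fun h => ?_, xd_pos_of_lt_abs⟩
  by_contra h'
  rcases (not_lt.1 h').lt_or_eq with h1 | h1
  · exact absurd h (xd_neg_of_abs_lt h1).not_gt
  · exact absurd (xd_eq_zero_of_abs_eq h1) h.ne'

/-- `x'(t) < 0 ↔ |t| < t₀`. [folklore] -/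
theorem xd_neg_iff {t : ℝ} : xd t < 0 ↔ |t| < t0 := by
  refine ⟨fun h => ?_, xd_neg_of_abs_lt⟩
  by_contra h'
  rcases (not_lt.1 h').lt_or_eq with h1 | h1
  · exact absurd h (xd_pos_of_lt_abs h1).not_gt
  · exact absurd (xd_eq_zero_of_abs_eq h1.symm) h.ne

/-- `x'(t) = 0 ↔ |t| = t₀`. [folklore] -/
theorem xd_eq_zero_iff {t : ℝ} : xd t = 0 ↔ |t| = t0 := by
  refine ⟨fun h => ?_, xd_eq_zero_of_abs_eq⟩
  rcases lt_trichotomy |t| t0 with h1 | h1 | h1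
  · exact absurd h (xd_neg_of_abs_lt h1).ne
  · exact h1
  · exact absurd h (xd_pos_of_lt_abs h1).ne'

/-- `x'(t) ≤ 0 ↔ |t| ≤ t₀`. [folklore] -/
theorem xd_nonpos_iff {t : ℝ} : xd t ≤ 0 ↔ |t| ≤ t0 := by
  rw [← not_lt, xd_pos_iff, not_lt]

/-- `x'(t₀) = 0`. [folklore] -/
theorem xd_t0 : xd t0 = 0 := xd_eq_zero_of_abs_eq abs_t0

/-- `x'(t) > 0` for `t₀ < t`. [folklore] -/
theorem xd_pos_of_t0_lt {t : ℝ} (ht : t0 < t) : 0 < xd t := xd_pos_of_lt_abs (ht.trans_le (le_abs_self t))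

/-! ### The closing identities -/

/-- `Y · x'` is integrable. [folklore] -/
theorem integrable_Y_mul_xd : Integrable fun t => Y t * xd t :=
  (continuous_Y.mul continuous_xd).integrable_of_hasCompactSupport hasCompactSupport_Y.mul_right

/-- **Closing of the `z`-coordinate**: `∫ Y x' = 0` (the choice of `A`). [folklore] -/
theorem integral_Y_mul_xd : ∫ t, Y t * xd t = 0 := by
  have h : (fun t => Y t * xd t) =
      fun t => (Y t - A * (Y t * bump t)) + A / 2 * (Y t * comp t) := by
    funext t; simp only [xd]; ring
  rw [h, integral_add (f := fun t => Y t - A * (Y t * bump t)) (g := fun t => A / 2 * (Y t * comp t))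
      (integrable_Y.sub (integrable_Y_mul_bump.const_mul A)) (integrable_Y_mul_comp.const_mul _),
    integral_sub (f := Y) (g := fun t => A * (Y t * bump t)) integrable_Y
      (integrable_Y_mul_bump.const_mul A),
    integral_const_mul, integral_const_mul, ← A_mul_D, D_eq]
  ring

/-- `x' - 1` is integrable. [folklore] -/
theorem integrable_xd_sub_one : Integrable fun t => xd t - 1 := by
  have h : (fun t => xd t - 1) = fun t => -(A * bump t) + A / 2 * comp t := by
    funext t; simp only [xd]; ring
  rw [h]
  exact (integrable_bump.const_mul A).neg.add
    ((continuous_comp.integrable_of_hasCompactSupport hasCompactSupport_comp).const_mul _)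

/-- **Closing of the `x`-coordinate**: `∫ (x' - 1) = 0` (the compensation bumps). [folklore] -/
theorem integral_xd_sub_one : ∫ t, (xd t - 1) = 0 := by
  have h : (fun t => xd t - 1) = fun t => -(A * bump t) + A / 2 * comp t := by
    funext t; simp only [xd]; ring
  rw [h, integral_add (f := fun t => -(A * bump t)) (g := fun t => A / 2 * comp t)
      (integrable_bump.const_mul A).neg
      ((continuous_comp.integrable_of_hasCompactSupport hasCompactSupport_comp).const_mul _),
    integral_neg, integral_const_mul, integral_const_mul, integral_comp, ← m]
  ring

/-- `x' - 1` vanishes for `7/2 ≤ |t|`. [folklore] -/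
theorem xd_sub_one_eq_zero_of_le_abs {t : ℝ} (ht : 7 / 2 ≤ |t|) : xd t - 1 = 0 := by
  rw [xd_eq_one_of_le_abs ht, sub_self]

/-- The support of `x' - 1` lies in `(-7/2, 7/2)`. [folklore] -/
theorem support_xd_sub_one : Function.support (fun t => xd t - 1) ⊆ Ioo (-(7 / 2)) (7 / 2) := by
  intro t ht
  rw [Function.mem_support] at ht
  have h : |t| < 7 / 2 := by
    by_contra h'; exact ht (xd_sub_one_eq_zero_of_le_abs (not_lt.1 h'))
  exact ⟨by linarith [neg_abs_le t], (le_abs_self t).trans_lt h⟩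

/-- Half of the closing integral of `x' - 1` vanishes (the integrand is even). [folklore] -/
theorem intervalIntegral_xd_sub_one_half : ∫ s in (0 : ℝ)..(7 / 2), (xd s - 1) = 0 := by
  have hint : ∀ a b : ℝ, IntervalIntegrable (fun s => xd s - 1) volume a b := fun a b =>
    (continuous_xd.sub continuous_const).intervalIntegrable a b
  have h1 : ∫ s in (-(7 / 2) : ℝ)..(7 / 2), (xd s - 1) = 0 := by
    rw [intervalIntegral.integral_eq_integral_of_support_subset
      (support_xd_sub_one.trans Ioo_subset_Ioc_self)]
    exact integral_xd_sub_one
  have h2 : ∫ s in (-(7 / 2) : ℝ)..0, (xd s - 1) = ∫ s in (0 : ℝ)..(7 / 2), (xd s - 1) := by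
    have := intervalIntegral.integral_comp_neg (a := (0 : ℝ)) (b := 7 / 2) (fun s => xd s - 1)
    simp only [xd_neg, neg_zero] at this
    rw [← this]
  have h3 := intervalIntegral.integral_add_adjacent_intervals (hint (-(7 / 2)) 0) (hint 0 (7 / 2))
  rw [h1, h2] at h3
  linarith

/-! ### The longitudinal coordinate `x` -/

/-- **The `x`-coordinate** `x(t) = ∫₀ᵗ x'` of the stabilised arc: odd, `x(t) = t` for
`|t| ≥ 7/2`, increasing off `[-t₀, t₀]` and decreasing on it. [folklore] -/
def xm (t : ℝ) : ℝ := ∫ s in (0 : ℝ)..t, xd s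

/-- `x' ` is the derivative of `x` (fundamental theorem of calculus). [folklore] -/
theorem hasDerivAt_xm (t : ℝ) : HasDerivAt xm (xd t) t :=
  intervalIntegral.integral_hasDerivAt_right (continuous_xd.intervalIntegrable _ _)
    (continuous_xd.stronglyMeasurableAtFilter _ _) continuous_xd.continuousAt

/-- `x` is differentiable. [folklore] -/
theorem differentiable_xm : Differentiable ℝ xm := fun t => (hasDerivAt_xm t).differentiableAt

/-- `deriv x = x'`. [folklore] -/
theorem deriv_xm : deriv xm = xd := funext fun t => (hasDerivAt_xm t).deriv

/-- `x` is continuous. [folklore] -/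
theorem continuous_xm : Continuous xm := differentiable_xm.continuous

/-- `x` is `C^∞`. [folklore] -/
theorem contDiff_xm : ContDiff ℝ ∞ xm :=
  contDiff_infty_iff_deriv.2 ⟨differentiable_xm, by rw [deriv_xm]; exact contDiff_xd⟩

/-- `x(0) = 0`. [folklore] -/
@[simp] theorem xm_zero : xm 0 = 0 := intervalIntegral.integral_same

/-- `x` is odd. [folklore] -/
theorem xm_neg (t : ℝ) : xm (-t) = -xm t := by
  have h := intervalIntegral.integral_comp_neg (a := (0 : ℝ)) (b := t) xd
  simp only [xd_neg, neg_zero] at h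
  rw [intervalIntegral.integral_symm (0 : ℝ) (-t)] at h
  simp only [xm]
  linarith

/-- `x(t) - t = ∫₀ᵗ (x' - 1)`. [folklore] -/
theorem xm_sub_self (t : ℝ) : xm t - t = ∫ s in (0 : ℝ)..t, (xd s - 1) := by
  rw [intervalIntegral.integral_sub (continuous_xd.intervalIntegrable (μ := volume) _ _)
    (continuous_const.intervalIntegrable (μ := volume) _ _), intervalIntegral.integral_const, xm]
  simp

/-- `x(t) = t` for `t ≥ 7/2`. [folklore] -/
theorem xm_eq_self_of_le {t : ℝ} (ht : 7 / 2 ≤ t) : xm t = t := by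
  have h1 : ∫ s in (7 / 2 : ℝ)..t, (xd s - 1) = 0 := by
    rw [intervalIntegral.integral_congr (g := fun _ => (0 : ℝ)) fun s hs => ?_]
    · simp
    · rw [uIcc_of_le ht] at hs
      exact xd_sub_one_eq_zero_of_le_abs (hs.1.trans (le_abs_self s))
  have h2 := intervalIntegral.integral_add_adjacent_intervals (a := (0 : ℝ)) (b := 7 / 2) (c := t)
    (f := fun s => xd s - 1) (μ := volume)
    ((continuous_xd.sub continuous_const).intervalIntegrable _ _)
    ((continuous_xd.sub continuous_const).intervalIntegrable _ _)
  rw [intervalIntegral_xd_sub_one_half, h1, ← xm_sub_self] at h2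
  linarith

/-- `x(t) = t` for `|t| ≥ 7/2`. [folklore] -/
theorem xm_eq_self {t : ℝ} (ht : 7 / 2 ≤ |t|) : xm t = t := by
  rcases le_abs'.1 ht with h | h
  · have := xm_eq_self_of_le (t := -t) (by linarith)
    rw [xm_neg] at this; linarith
  · exact xm_eq_self_of_le h

/-- Uniform closeness of `x` to the identity. [folklore] -/
theorem abs_xm_sub_self_le (t : ℝ) : |xm t - t| ≤ 7 * A := by
  have hA := A_pos
  rcases le_or_gt (7 / 2) |t| with h | h
  · rw [xm_eq_self h, sub_self, abs_zero]; positivity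
  · rw [xm_sub_self]
    have h1 := intervalIntegral.norm_integral_le_of_norm_le_const (a := (0 : ℝ)) (b := t)
      (C := 2 * A) (f := fun s => xd s - 1) fun s _ => abs_xd_sub_one_le s
    rw [Real.norm_eq_abs, sub_zero] at h1
    refine h1.trans ?_
    nlinarith [abs_nonneg t]

/-- `x` is strictly increasing on `[t₀, ∞)`. [folklore] -/
theorem strictMonoOn_xm_Ici : StrictMonoOn xm (Ici t0) :=
  strictMonoOn_of_deriv_pos (convex_Ici _) continuous_xm.continuousOn fun s hs => by
    rw [interior_Ici] at hs
    rw [deriv_xm]; exact xd_pos_of_t0_lt hs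

/-- `x` is strictly increasing on `(-∞, -t₀]`. [folklore] -/
theorem strictMonoOn_xm_Iic : StrictMonoOn xm (Iic (-t0)) :=
  strictMonoOn_of_deriv_pos (convex_Iic _) continuous_xm.continuousOn fun s hs => by
    rw [interior_Iic] at hs
    rw [deriv_xm]
    exact xd_pos_of_lt_abs (by rw [abs_of_neg (by linarith [t0_pos, hs.out])]; linarith [hs.out])

/-- `x` is strictly decreasing on `[-t₀, t₀]`. [folklore] -/
theorem strictAntiOn_xm_Icc : StrictAntiOn xm (Icc (-t0) t0) :=
  strictAntiOn_of_deriv_neg (convex_Icc _ _) continuous_xm.continuousOn fun s hs => by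
    rw [interior_Icc] at hs
    rw [deriv_xm]; exact xd_neg_of_abs_lt (abs_lt.2 hs)

/-! ### The vertical coordinate `z` -/

/-- **The `z`-coordinate** `z(t) = ∫₋₄ᵗ Y x'` of the stabilised arc (so that `z' = y x'`, the
Legendrian condition for `dz - y dx`): odd, vanishing for `|t| ≥ 4`, negative on `(0, 4)`. [folklore] -/
def zm (t : ℝ) : ℝ := ∫ s in (-4 : ℝ)..t, Y s * xd s

/-- `Y x'` is the derivative of `z` (fundamental theorem of calculus). [folklore] -/
theorem hasDerivAt_zm (t : ℝ) : HasDerivAt zm (Y t * xd t) t :=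
  intervalIntegral.integral_hasDerivAt_right ((continuous_Y.mul continuous_xd).intervalIntegrable _ _)
    ((continuous_Y.mul continuous_xd).stronglyMeasurableAtFilter _ _)
    (continuous_Y.mul continuous_xd).continuousAt

/-- `z` is differentiable. [folklore] -/
theorem differentiable_zm : Differentiable ℝ zm := fun t => (hasDerivAt_zm t).differentiableAt

/-- `deriv z = Y x'`. [folklore] -/
theorem deriv_zm : deriv zm = fun t => Y t * xd t := funext fun t => (hasDerivAt_zm t).deriv

/-- `z` is continuous. [folklore] -/
theorem continuous_zm : Continuous zm := differentiable_zm.continuous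

/-- `z` is `C^∞`. [folklore] -/
theorem contDiff_zm : ContDiff ℝ ∞ zm :=
  contDiff_infty_iff_deriv.2 ⟨differentiable_zm, by rw [deriv_zm]; exact contDiff_Y.mul contDiff_xd⟩

/-- `z(t) = 0` for `t ≤ -4`. [folklore] -/
theorem zm_eq_zero_of_le_neg {t : ℝ} (ht : t ≤ -4) : zm t = 0 := by
  rw [zm, intervalIntegral.integral_congr (g := fun _ => (0 : ℝ)) fun s hs => ?_]
  · simp
  · rw [uIcc_of_ge ht] at hs
    show Y s * xd s = 0
    rw [Y_eq_zero (by rw [abs_of_nonpos (by linarith [hs.2])]; linarith [hs.2]), zero_mul]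

/-- **`z(4) = 0`** (the closing condition `∫ Y x' = 0`). [folklore] -/
theorem zm_four : zm 4 = 0 := by
  rw [zm, intervalIntegral.integral_eq_integral_of_support_subset fun s hs => ?_]
  · exact integral_Y_mul_xd
  · rw [Function.mem_support] at hs
    have h : Y s ≠ 0 := fun h => hs (by rw [h, zero_mul])
    have h' : |s| < 4 := Y_pos_iff.1 ((Y_nonneg s).lt_of_ne' h)
    exact ⟨by linarith [neg_abs_le s], (le_abs_self s).trans (le_of_lt h')⟩

/-- `z(t) = 0` for `4 ≤ t`. [folklore] -/
theorem zm_eq_zero_of_le {t : ℝ} (ht : 4 ≤ t) : zm t = 0 := by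
  have h1 : ∫ s in (4 : ℝ)..t, Y s * xd s = 0 := by
    rw [intervalIntegral.integral_congr (g := fun _ => (0 : ℝ)) fun s hs => ?_]
    · simp
    · rw [uIcc_of_le ht] at hs
      show Y s * xd s = 0
      rw [Y_eq_zero (hs.1.trans (le_abs_self s)), zero_mul]
  have h2 := intervalIntegral.integral_add_adjacent_intervals (a := (-4 : ℝ)) (b := 4) (c := t)
    (f := fun s => Y s * xd s) (μ := volume)
    ((continuous_Y.mul continuous_xd).intervalIntegrable _ _)
    ((continuous_Y.mul continuous_xd).intervalIntegrable _ _)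
  rw [h1, add_zero] at h2
  rw [zm, ← h2]; exact zm_four

/-- `z(t) = 0` for `4 ≤ |t|`. [folklore] -/
theorem zm_eq_zero {t : ℝ} (ht : 4 ≤ |t|) : zm t = 0 := by
  rcases le_abs'.1 ht with h | h
  · exact zm_eq_zero_of_le_neg h
  · exact zm_eq_zero_of_le h

/-- `z` is odd. [folklore] -/
theorem zm_neg (t : ℝ) : zm (-t) = -zm t := by
  have h := intervalIntegral.integral_comp_neg (a := (-4 : ℝ)) (b := -t) (fun s => Y s * xd s)
  simp only [Y_neg, xd_neg, neg_neg] at h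
  -- `h : ∫ x in -4..-t, Y x * xd x = ∫ x in t..4, Y x * xd x`
  have h2 := intervalIntegral.integral_add_adjacent_intervals (a := (-4 : ℝ)) (b := t) (c := 4)
    (f := fun s => Y s * xd s) (μ := volume)
    ((continuous_Y.mul continuous_xd).intervalIntegrable _ _)
    ((continuous_Y.mul continuous_xd).intervalIntegrable _ _)
  have h4 : ∫ x in (-4 : ℝ)..4, Y x * xd x = 0 := zm_four
  rw [h4] at h2
  rw [zm, zm, h]
  linarith

/-- `z(0) = 0`. [folklore] -/
@[simp] theorem zm_zero : zm 0 = 0 := by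
  have := zm_neg 0
  rw [neg_zero] at this; linarith

/-- `z` is strictly decreasing on `[0, t₀]`. [folklore] -/
theorem strictAntiOn_zm : StrictAntiOn zm (Icc 0 t0) :=
  strictAntiOn_of_deriv_neg (convex_Icc _ _) continuous_zm.continuousOn fun s hs => by
    rw [interior_Icc] at hs
    rw [deriv_zm]
    exact mul_neg_of_pos_of_neg (Y_pos (by rw [abs_of_pos hs.1]; linarith [hs.2, t0_lt_one]))
      (xd_neg_of_abs_lt (by rw [abs_of_pos hs.1]; exact hs.2))

/-- `z` is strictly increasing on `[t₀, 4]`. [folklore] -/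
theorem strictMonoOn_zm : StrictMonoOn zm (Icc t0 4) :=
  strictMonoOn_of_deriv_pos (convex_Icc _ _) continuous_zm.continuousOn fun s hs => by
    rw [interior_Icc] at hs
    rw [deriv_zm]
    exact mul_pos (Y_pos (by rw [abs_of_pos (t0_pos.trans hs.1)]; exact hs.2))
      (xd_pos_of_t0_lt hs.1)

/-- **`z < 0` on `(0, 4)`.** [folklore] -/
theorem zm_neg_of_mem {t : ℝ} (ht : t ∈ Ioo (0 : ℝ) 4) : zm t < 0 := by
  rcases le_or_gt t t0 with h | h
  · have := strictAntiOn_zm ⟨le_rfl, t0_pos.le⟩ ⟨ht.1.le, h⟩ ht.1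
    rwa [zm_zero] at this
  · have := strictMonoOn_zm ⟨h.le, ht.2.le⟩ ⟨(t0_lt_one.trans (by norm_num)).le, le_rfl⟩ ht.2
    rwa [zm_four] at this

/-- `z > 0` on `(-4, 0)`. [folklore] -/
theorem zm_pos_of_mem {t : ℝ} (ht : t ∈ Ioo (-4 : ℝ) 0) : 0 < zm t := by
  have := zm_neg_of_mem (t := -t) ⟨by linarith [ht.2], by linarith [ht.1]⟩
  rw [zm_neg] at this; linarith

/-- `z(t) ≠ 0` for `0 < |t| < 4`. [folklore] -/
theorem zm_ne_zero {t : ℝ} (h0 : t ≠ 0) (h4 : |t| < 4) : zm t ≠ 0 := by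
  rcases lt_or_gt_of_ne h0 with h | h
  · exact (zm_pos_of_mem ⟨by linarith [neg_abs_le t], h⟩).ne'
  · exact (zm_neg_of_mem ⟨h, (le_abs_self t).trans_lt h4⟩).ne

/-- `|x'| ≤ 1 + 2A`. [folklore] -/
theorem abs_xd_le (t : ℝ) : |xd t| ≤ 1 + 2 * A := by
  have := abs_xd_sub_one_le t
  have h := abs_add_le (xd t - 1) 1
  rw [sub_add_cancel, abs_one] at h
  linarith

/-- Uniform bound for `z`. [folklore] -/
theorem abs_zm_le (t : ℝ) : |zm t| ≤ 8 * (1 + 2 * A) := by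
  have hA := A_pos
  rcases le_or_gt 4 |t| with h | h
  · rw [zm_eq_zero h, abs_zero]; positivity
  · have h1 := intervalIntegral.norm_integral_le_of_norm_le_const (a := (-4 : ℝ)) (b := t)
      (C := 1 + 2 * A) (f := fun s => Y s * xd s) fun s _ => by
        rw [Real.norm_eq_abs, abs_mul]
        calc |Y s| * |xd s| ≤ 1 * (1 + 2 * A) :=
              mul_le_mul (by rw [abs_of_nonneg (Y_nonneg s)]; exact Y_le_one s) (abs_xd_le s)
                (abs_nonneg _) zero_le_one
          _ = 1 + 2 * A := one_mul _
    rw [Real.norm_eq_abs] at h1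
    refine h1.trans ?_
    have : |t - -4| ≤ 8 := by rw [abs_le]; constructor <;> linarith [abs_lt.1 h]
    nlinarith

/-! ### The straight-line isotopy of space curves `K_τ = (1 - τ) · axis + τ · K₁` -/

/-- `ℝ³`. -/
local notation "E3" => EuclideanSpace ℝ (Fin 3)

/-- The point `(t, 0, 0)` of the `x`-axis. [folklore] -/
def axisPt (t : ℝ) : E3 := !₂[t, 0, 0]

/-- **The isotopy of model curves** `K_τ(t) = (t + τ (x(t) - t), τ Y(t), τ z(t))`: the straight
line from the `x`-axis `K₀` to the stabilised Legendrian arc `K₁ = (x, Y, z)`. [folklore] -/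
def curve (τ t : ℝ) : E3 := !₂[t + τ * (xm t - t), τ * Y t, τ * zm t]

/-- The velocity of `K_τ`. [folklore] -/
def dcurve (τ t : ℝ) : E3 := !₂[1 + τ * (xd t - 1), τ * dY t, τ * (Y t * xd t)]

/-- Coordinates of the axis point. [folklore] -/
@[simp] theorem axisPt_apply_zero (t : ℝ) : axisPt t 0 = t := by simp [axisPt]
/-- Coordinates of the axis point. [folklore] -/
@[simp] theorem axisPt_apply_one (t : ℝ) : axisPt t 1 = 0 := by simp [axisPt]
/-- Coordinates of the axis point. [folklore] -/
@[simp] theorem axisPt_apply_two (t : ℝ) : axisPt t 2 = 0 := by simp [axisPt]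
/-- The `x`-coordinate of `K_τ`. [folklore] -/
@[simp] theorem curve_apply_zero (τ t : ℝ) : curve τ t 0 = t + τ * (xm t - t) := by simp [curve]
/-- The `y`-coordinate of `K_τ`. [folklore] -/
@[simp] theorem curve_apply_one (τ t : ℝ) : curve τ t 1 = τ * Y t := by simp [curve]
/-- The `z`-coordinate of `K_τ`. [folklore] -/
@[simp] theorem curve_apply_two (τ t : ℝ) : curve τ t 2 = τ * zm t := by simp [curve]
/-- The `x`-component of the velocity of `K_τ`. [folklore] -/
@[simp] theorem dcurve_apply_zero (τ t : ℝ) : dcurve τ t 0 = 1 + τ * (xd t - 1) := by simp [dcurve]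
/-- The `y`-component of the velocity of `K_τ`. [folklore] -/
@[simp] theorem dcurve_apply_one (τ t : ℝ) : dcurve τ t 1 = τ * dY t := by simp [dcurve]
/-- The `z`-component of the velocity of `K_τ`. [folklore] -/
@[simp] theorem dcurve_apply_two (τ t : ℝ) : dcurve τ t 2 = τ * (Y t * xd t) := by simp [dcurve]

/-- Vectors of `ℝ³` with equal coordinates are equal. [folklore] -/
theorem euclidean_three_ext {v w : E3} (h0 : v 0 = w 0) (h1 : v 1 = w 1) (h2 : v 2 = w 2) : v = w := by
  ext i; fin_cases i <;> assumption

/-- At `τ = 0` the curve is the `x`-axis. [folklore] -/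
@[simp] theorem curve_zero_left (t : ℝ) : curve 0 t = axisPt t :=
  euclidean_three_ext (by simp) (by simp) (by simp)

/-- Off `(-4, 4)` every stage is the `x`-axis. [folklore] -/
theorem curve_eq_axisPt {τ t : ℝ} (ht : 4 ≤ |t|) : curve τ t = axisPt t :=
  euclidean_three_ext (by simp [xm_eq_self (le_trans (by norm_num) ht)]) (by simp [Y_eq_zero ht])
    (by simp [zm_eq_zero ht])

/-- Off `(-4, 4)` every stage has unit speed along the axis. [folklore] -/
theorem dcurve_eq {τ t : ℝ} (ht : 4 ≤ |t|) : dcurve τ t = !₂[1, 0, 0] :=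
  euclidean_three_ext (by simp [xd_eq_one_of_le_abs (le_trans (by norm_num) ht)])
    (by simp [dY_eq_zero ht]) (by simp [Y_eq_zero ht])

/-- A map into `ℝ³` given by three coordinate functions is differentiable with the expected
derivative. [folklore] -/
theorem hasDerivAt_euclidean_three {f g h : ℝ → ℝ} {f' g' h' t : ℝ} (hf : HasDerivAt f f' t)
    (hg : HasDerivAt g g' t) (hh : HasDerivAt h h' t) :
    HasDerivAt (fun s => (!₂[f s, g s, h s] : E3)) (!₂[f', g', h']) t := by
  have key : HasDerivAt (fun s => (![f s, g s, h s] : Fin 3 → ℝ)) (![f', g', h']) t := by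
    rw [hasDerivAt_pi]
    intro i; fin_cases i <;> simpa
  exact (EuclideanSpace.equiv (Fin 3) ℝ).symm.hasFDerivAt.comp_hasDerivAt t key

/-- The velocity of the model curves. [folklore] -/
theorem hasDerivAt_curve (τ t : ℝ) : HasDerivAt (curve τ) (dcurve τ t) t := by
  have h1 : HasDerivAt (fun s => s + τ * (xm s - s)) (1 + τ * (xd t - 1)) t := by
    have ha : HasDerivAt (fun s => xm s - s) (xd t - 1) t := (hasDerivAt_xm t).fun_sub (hasDerivAt_id t)
    exact (hasDerivAt_id t).fun_add (ha.const_mul τ)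
  have h2 : HasDerivAt (fun s => τ * Y s) (τ * dY t) t := (hasDerivAt_Y t).const_mul τ
  have h3 : HasDerivAt (fun s => τ * zm s) (τ * (Y t * xd t)) t := (hasDerivAt_zm t).const_mul τ
  exact hasDerivAt_euclidean_three h1 h2 h3

/-- `deriv (K_τ) = dcurve τ`. [folklore] -/
theorem deriv_curve (τ t : ℝ) : deriv (curve τ) t = dcurve τ t := (hasDerivAt_curve τ t).deriv

/-- **The Legendrian condition at `τ = 1`**: `z' = y x'` for the model form `dz - y dx`. [folklore] -/
theorem dcurve_one_legendrian (t : ℝ) : dcurve 1 t 2 = curve 1 t 1 * dcurve 1 t 0 := by simp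

/-- Joint smoothness of `(τ, t) ↦ K_τ(t)`. [folklore] -/
theorem contDiff_curve : ContDiff ℝ ∞ fun p : ℝ × ℝ => curve p.1 p.2 := by
  have hxm : ContDiff ℝ ∞ fun p : ℝ × ℝ => xm p.2 := contDiff_xm.comp contDiff_snd
  have hY : ContDiff ℝ ∞ fun p : ℝ × ℝ => Y p.2 := contDiff_Y.comp contDiff_snd
  have hzm : ContDiff ℝ ∞ fun p : ℝ × ℝ => zm p.2 := contDiff_zm.comp contDiff_snd
  have h : ContDiff ℝ ∞ fun p : ℝ × ℝ =>
      (![p.2 + p.1 * (xm p.2 - p.2), p.1 * Y p.2, p.1 * zm p.2] : Fin 3 → ℝ) := by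
    rw [contDiff_pi]
    intro i; fin_cases i
    · simpa using contDiff_snd.add (contDiff_fst.mul (hxm.sub contDiff_snd))
    · simpa using contDiff_fst.mul hY
    · simpa using contDiff_fst.mul hzm
  exact (EuclideanSpace.equiv (Fin 3) ℝ).symm.contDiff.comp h

/-- Every stage `K_τ` is `C^∞`. [folklore] -/
theorem contDiff_curve_left (τ : ℝ) : ContDiff ℝ ∞ (curve τ) :=
  contDiff_curve.comp (contDiff_const.prodMk contDiff_id)

/-- `(τ, t) ↦ K_τ(t)` is continuous. [folklore] -/
theorem continuous_curve : Continuous fun p : ℝ × ℝ => curve p.1 p.2 := contDiff_curve.continuous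

/-- **Every stage is an immersion**: the velocity never vanishes (for `0 ≤ τ ≤ 1`). [folklore] -/
theorem dcurve_ne_zero {τ : ℝ} (hτ : τ ∈ Icc (0 : ℝ) 1) (t : ℝ) : dcurve τ t ≠ 0 := by
  intro h
  have h0 : 1 + τ * (xd t - 1) = 0 := by simpa using congrArg (fun v : E3 => v 0) h
  have h1 : τ * dY t = 0 := by simpa using congrArg (fun v : E3 => v 1) h
  have h2 : τ * (Y t * xd t) = 0 := by simpa using congrArg (fun v : E3 => v 2) h
  have hτ0 : τ ≠ 0 := by rintro rfl; simp at h0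
  have hτpos : 0 < τ := hτ.1.lt_of_ne' hτ0
  -- `x' ≤ 0`, so `|t| ≤ t₀ < 4`
  have hxd : xd t ≤ 0 := by nlinarith [hτ.2]
  have ht : |t| ≤ t0 := xd_nonpos_iff.1 hxd
  have ht4 : |t| < 4 := ht.trans_lt (t0_lt_one.trans (by norm_num))
  rcases eq_or_ne t 0 with rfl | htne
  · have : Y 0 * xd 0 = 0 := by simpa [hτ0] using h2
    exact absurd this (mul_ne_zero (Y_pos (by simp)).ne' xd_zero_neg.ne)
  · exact absurd ((mul_eq_zero.1 h1).resolve_left hτ0) (dY_ne_zero htne ht4)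

/-- **Every stage is injective** (for `0 ≤ τ ≤ 1`): `Y` is even and strictly decreasing in `|t|`,
so a double point has parameters `±t`; `z` is odd and non-zero on `(-4, 4) ∖ {0}`. [folklore] -/
theorem curve_injective {τ : ℝ} (hτ : τ ∈ Icc (0 : ℝ) 1) : Function.Injective (curve τ) := by
  intro s t h
  have h0 : s + τ * (xm s - s) = t + τ * (xm t - t) := by simpa using congrArg (fun v : E3 => v 0) h
  have h1 : τ * Y s = τ * Y t := by simpa using congrArg (fun v : E3 => v 1) h
  have h2 : τ * zm s = τ * zm t := by simpa using congrArg (fun v : E3 => v 2) h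
  rcases eq_or_ne τ 0 with rfl | hτ0
  · simpa using h0
  have hY : Y s = Y t := mul_left_cancel₀ hτ0 h1
  have hz : zm s = zm t := mul_left_cancel₀ hτ0 h2
  rcases eq_or_ne (Y t) 0 with hYt | hYt
  · -- both parameters are off `(-4, 4)`, where `x = id`
    have ht : 4 ≤ |t| := Y_eq_zero_iff.1 hYt
    have hs : 4 ≤ |s| := Y_eq_zero_iff.1 (hY.trans hYt)
    rw [xm_eq_self (le_trans (by norm_num) hs), xm_eq_self (le_trans (by norm_num) ht)] at h0
    simpa using h0
  · have hYpos : 0 < Y t := (Y_nonneg t).lt_of_ne' hYt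
    have hst : |s| = |t| := abs_eq_abs_of_Y_eq hY hYpos
    have ht4 : |t| < 4 := Y_pos_iff.1 hYpos
    rcases (abs_eq_abs.1 hst) with hst' | hst'
    · exact hst'
    · -- `s = -t`: then `z(t) = 0`, forcing `t = 0 = s`
      subst hst'
      rw [zm_neg] at hz
      have hz0 : zm t = 0 := by linarith
      by_contra hne
      have htne : t ≠ 0 := fun h0' => hne (by rw [h0', neg_zero])
      exact zm_ne_zero htne ht4 hz0

/-- The Euclidean norm in `ℝ³` is at most the sum of the absolute values of the coordinates. [folklore] -/
theorem norm_le_of_abs_le {v : E3} {a b c : ℝ} (h0 : |v 0| ≤ a) (h1 : |v 1| ≤ b) (h2 : |v 2| ≤ c) :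
    ‖v‖ ≤ a + b + c := by
  have ha : 0 ≤ a := (abs_nonneg _).trans h0
  have hb : 0 ≤ b := (abs_nonneg _).trans h1
  have hc : 0 ≤ c := (abs_nonneg _).trans h2
  rw [EuclideanSpace.norm_eq, Real.sqrt_le_iff]
  refine ⟨by positivity, ?_⟩
  rw [Fin.sum_univ_three]
  simp only [Real.norm_eq_abs]
  have e0 : ‖v‖ = ‖v‖ := rfl
  nlinarith [sq_nonneg (|v.ofLp 0|), abs_nonneg (v.ofLp 0), abs_nonneg (v.ofLp 1), abs_nonneg (v.ofLp 2),
    mul_nonneg ha hb, mul_nonneg hb hc, mul_nonneg ha hc,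
    mul_le_mul h0 h0 (abs_nonneg _) ha, mul_le_mul h1 h1 (abs_nonneg _) hb,
    mul_le_mul h2 h2 (abs_nonneg _) hc]

/-- **The `C⁰`-size of the model**: `Cmodel = 7A + 1 + 8(1 + 2A)`. [folklore] -/
def Cmodel : ℝ := 7 * A + 1 + 8 * (1 + 2 * A)

/-- `Cmodel > 0`. [folklore] -/
theorem Cmodel_pos : 0 < Cmodel := by have := A_pos; unfold Cmodel; positivity

/-- Every stage stays within `Cmodel` of the axis, pointwise in the parameter. [folklore] -/
theorem norm_curve_sub_axisPt_le {τ : ℝ} (hτ : τ ∈ Icc (0 : ℝ) 1) (t : ℝ) :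
    ‖curve τ t - axisPt t‖ ≤ Cmodel := by
  have hτabs : |τ| ≤ 1 := by rw [abs_of_nonneg hτ.1]; exact hτ.2
  refine norm_le_of_abs_le (a := 7 * A) (b := 1) (c := 8 * (1 + 2 * A)) ?_ ?_ ?_
  · have : (curve τ t - axisPt t) 0 = τ * (xm t - t) := by simp
    rw [this, abs_mul]
    calc |τ| * |xm t - t| ≤ 1 * (7 * A) :=
          mul_le_mul hτabs (abs_xm_sub_self_le t) (abs_nonneg _) zero_le_one
      _ = 7 * A := one_mul _
  · have : (curve τ t - axisPt t) 1 = τ * Y t := by simp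
    rw [this, abs_mul, abs_of_nonneg (Y_nonneg t)]
    calc |τ| * Y t ≤ 1 * 1 := mul_le_mul hτabs (Y_le_one t) (Y_nonneg t) zero_le_one
      _ = 1 := one_mul _
  · have : (curve τ t - axisPt t) 2 = τ * zm t := by simp
    rw [this, abs_mul]
    calc |τ| * |zm t| ≤ 1 * (8 * (1 + 2 * A)) :=
          mul_le_mul hτabs (abs_zm_le t) (abs_nonneg _) zero_le_one
      _ = 8 * (1 + 2 * A) := one_mul _

/-! ### Rescaling by the contact dilation `(x, y, z) ↦ (ε x, ε y, ε² z)` -/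

/-- The contact dilation `δ_ε (x, y, z) = (ε x, ε y, ε² z)` (`δ_ε^* (dz - y dx) = ε² (dz - y dx)`). [folklore] -/
def dil (ε : ℝ) (v : E3) : E3 := !₂[ε * v 0, ε * v 1, ε ^ 2 * v 2]

/-- Coordinates of the dilation. [folklore] -/
@[simp] theorem dil_apply_zero (ε : ℝ) (v : E3) : dil ε v 0 = ε * v 0 := by simp [dil]
/-- Coordinates of the dilation. [folklore] -/
@[simp] theorem dil_apply_one (ε : ℝ) (v : E3) : dil ε v 1 = ε * v 1 := by simp [dil]
/-- Coordinates of the dilation. [folklore] -/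
@[simp] theorem dil_apply_two (ε : ℝ) (v : E3) : dil ε v 2 = ε ^ 2 * v 2 := by simp [dil]

/-- The dilation as a continuous linear map. [folklore] -/
def dilL (ε : ℝ) : E3 →L[ℝ] E3 :=
  LinearMap.toContinuousLinearMap
    { toFun := dil ε
      map_add' := fun v w => euclidean_three_ext (by simp [mul_add]) (by simp [mul_add]) (by simp [mul_add])
      map_smul' := fun c v => euclidean_three_ext (by simp; ring) (by simp; ring) (by simp; ring) }

/-- `dilL ε` is `dil ε`. [folklore] -/
@[simp] theorem dilL_apply (ε : ℝ) (v : E3) : dilL ε v = dil ε v := rfl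

/-- The dilation maps the axis to itself: `δ_ε (t, 0, 0) = (ε t, 0, 0)`. [folklore] -/
theorem dil_axisPt (ε t : ℝ) : dil ε (axisPt t) = axisPt (ε * t) :=
  euclidean_three_ext (by simp) (by simp) (by simp)

/-- The dilation is injective for `ε ≠ 0`. [folklore] -/
theorem dil_injective {ε : ℝ} (hε : ε ≠ 0) : Function.Injective (dil ε) := fun v w h =>
  euclidean_three_ext (by simpa [hε] using congrArg (fun u : E3 => u 0) h)
    (by simpa [hε] using congrArg (fun u : E3 => u 1) h)
    (by simpa [hε] using congrArg (fun u : E3 => u 2) h)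

/-- **The rescaled isotopy** `K^ε_τ(t) = δ_ε K_τ(t/ε)`, supported in `|t| < 4ε`. [folklore] -/
def scurve (ε τ t : ℝ) : E3 := dil ε (curve τ (t / ε))

/-- The velocity of the rescaled curves: `(x_τ', y_τ', ε z_τ')` at `t/ε`. [folklore] -/
def dscurve (ε τ t : ℝ) : E3 :=
  !₂[dcurve τ (t / ε) 0, dcurve τ (t / ε) 1, ε * dcurve τ (t / ε) 2]

/-- Off `(-4ε, 4ε)` every rescaled stage is the axis, `K^ε_τ(t) = (t, 0, 0)`. [folklore] -/
theorem scurve_eq_axisPt {ε τ t : ℝ} (hε : 0 < ε) (ht : 4 * ε ≤ |t|) : scurve ε τ t = axisPt t := by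
  have h : 4 ≤ |t / ε| := by
    rw [abs_div, abs_of_pos hε, le_div_iff₀ hε]; exact ht
  rw [scurve, curve_eq_axisPt h, dil_axisPt, mul_div_cancel₀ _ hε.ne']

/-- The rescaled isotopy starts at the axis. [folklore] -/
@[simp] theorem scurve_zero_left (ε : ℝ) (hε : ε ≠ 0) (t : ℝ) : scurve ε 0 t = axisPt t := by
  rw [scurve, curve_zero_left, dil_axisPt, mul_div_cancel₀ _ hε]

/-- Every rescaled stage is injective (`ε ≠ 0`, `0 ≤ τ ≤ 1`). [folklore] -/
theorem scurve_injective {ε τ : ℝ} (hε : ε ≠ 0) (hτ : τ ∈ Icc (0 : ℝ) 1) :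
    Function.Injective (scurve ε τ) := fun s t h => by
  have := curve_injective hτ (dil_injective hε h)
  field_simp at this
  exact this

/-- The velocity of the rescaled stages. [folklore] -/
theorem hasDerivAt_scurve {ε : ℝ} (hε : ε ≠ 0) (τ t : ℝ) :
    HasDerivAt (scurve ε τ) (dscurve ε τ t) t := by
  have h1 : HasDerivAt (fun s => curve τ (s / ε)) ((1 / ε) • dcurve τ (t / ε)) t :=
    HasDerivAt.scomp (g₁ := curve τ) (h := fun s => s / ε) t (hasDerivAt_curve τ (t / ε))
      ((hasDerivAt_id' t).div_const ε)
  have h2 := (dilL ε).hasFDerivAt.comp_hasDerivAt t h1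
  have h3 : (dilL ε) ((1 / ε) • dcurve τ (t / ε)) = dscurve ε τ t := by
    refine euclidean_three_ext ?_ ?_ ?_ <;> simp [dscurve] <;> field_simp
  rw [h3] at h2
  exact h2

/-- Every rescaled stage is an immersion (`ε ≠ 0`, `0 ≤ τ ≤ 1`). [folklore] -/
theorem dscurve_ne_zero {ε τ : ℝ} (hε : ε ≠ 0) (hτ : τ ∈ Icc (0 : ℝ) 1) (t : ℝ) :
    dscurve ε τ t ≠ 0 := by
  intro h
  apply dcurve_ne_zero hτ (t / ε)
  refine euclidean_three_ext ?_ ?_ ?_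
  · simpa [dscurve] using congrArg (fun v : E3 => v 0) h
  · simpa [dscurve] using congrArg (fun v : E3 => v 1) h
  · have := congrArg (fun v : E3 => v 2) h
    simp [dscurve, hε] at this
    simpa using this

/-- **The rescaled arc at `τ = 1` is Legendrian** for `dz - y dx`: `z' = y x'`. [folklore] -/
theorem dscurve_one_legendrian (ε t : ℝ) : dscurve ε 1 t 2 = scurve ε 1 t 1 * dscurve ε 1 t 0 := by
  simp [dscurve, scurve]; ring

/-- Joint smoothness of the rescaled family. [folklore] -/
theorem contDiff_scurve (ε : ℝ) : ContDiff ℝ ∞ fun p : ℝ × ℝ => scurve ε p.1 p.2 := by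
  have h : ContDiff ℝ ∞ fun p : ℝ × ℝ => curve p.1 (p.2 / ε) :=
    contDiff_curve.comp (contDiff_fst.prodMk (contDiff_snd.div_const ε))
  exact (dilL ε).contDiff.comp h

/-- **`C⁰`-smallness of the rescaled family**: within `ε · Cmodel` of the axis, pointwise in the
parameter, for `0 < ε ≤ 1`. [folklore] -/
theorem norm_scurve_sub_axisPt_le {ε τ : ℝ} (hε : 0 < ε) (hε1 : ε ≤ 1) (hτ : τ ∈ Icc (0 : ℝ) 1)
    (t : ℝ) : ‖scurve ε τ t - axisPt t‖ ≤ ε * Cmodel := by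
  have hA := A_pos
  have hτabs : |τ| ≤ 1 := by rw [abs_of_nonneg hτ.1]; exact hτ.2
  have hεabs : |ε| = ε := abs_of_pos hε
  have h := norm_le_of_abs_le (v := scurve ε τ t - axisPt t) (a := ε * (7 * A)) (b := ε)
    (c := ε * (8 * (1 + 2 * A))) ?_ ?_ ?_
  · refine h.trans (le_of_eq ?_); unfold Cmodel; ring
  · have : (scurve ε τ t - axisPt t) 0 = ε * (τ * (xm (t / ε) - t / ε)) := by
      simp [scurve]; field_simp; ring
    rw [this, abs_mul, abs_mul, hεabs]
    refine mul_le_mul_of_nonneg_left ?_ hε.le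
    calc |τ| * |xm (t / ε) - t / ε| ≤ 1 * (7 * A) :=
          mul_le_mul hτabs (abs_xm_sub_self_le _) (abs_nonneg _) zero_le_one
      _ = 7 * A := one_mul _
  · have : (scurve ε τ t - axisPt t) 1 = ε * (τ * Y (t / ε)) := by simp [scurve]
    rw [this, abs_mul, abs_mul, hεabs, abs_of_nonneg (Y_nonneg _)]
    calc ε * (|τ| * Y (t / ε)) ≤ ε * (1 * 1) :=
          mul_le_mul_of_nonneg_left (mul_le_mul hτabs (Y_le_one _) (Y_nonneg _) zero_le_one) hε.le
      _ = ε := by ring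
  · have : (scurve ε τ t - axisPt t) 2 = ε ^ 2 * (τ * zm (t / ε)) := by simp [scurve]
    rw [this, abs_mul, abs_mul, abs_of_nonneg (sq_nonneg ε)]
    have h1 : |τ| * |zm (t / ε)| ≤ 8 * (1 + 2 * A) := by
      calc |τ| * |zm (t / ε)| ≤ 1 * (8 * (1 + 2 * A)) :=
            mul_le_mul hτabs (abs_zm_le _) (abs_nonneg _) zero_le_one
        _ = 8 * (1 + 2 * A) := one_mul _
    have h2 : ε ^ 2 ≤ ε := by nlinarith
    calc ε ^ 2 * (|τ| * |zm (t / ε)|) ≤ ε ^ 2 * (8 * (1 + 2 * A)) :=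
          mul_le_mul_of_nonneg_left h1 (sq_nonneg ε)
      _ ≤ ε * (8 * (1 + 2 * A)) := mul_le_mul_of_nonneg_right h2 (by positivity)

end Literature.Geometry.Symplectic.LegendrianModel

end
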